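import Mathlib
import Literature.Computability.Complexity.RossmanMonotoneClique
import Summits.PneNP.PneNP.Theses.OneSlice

/-!
# Sketch — crux-ideate stmt-PneNP-2833 (`SingleThreshold`), round 1, ideator 2

First lemmas (statements only, no proofs claimed) for the two idea cards

* `self-noise-closure`  — closure with respect to the critical law `G(n,p_θ)` itself;
* `error-profile-rigidity` — false-positive / false-negative slice profiles of a monotone
  function are rigid across the critical window (shadow / LYM double counting); plus the
  coarseness of local parts (Russo) used in the negative notes.

Everything is typed over `Literature.Computability.Complexity.{gnpProb, gnpWeight, edgeCount,
cliqueVec, plantClique, cliqueFn, kSubsetProb, Circuit, monotoneBasis}` and Mathlib.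
-/

noncomputable section

namespace Summit.PneNP.PneNP.Cruxes.SingleThreshold.Ideator2

open Finset Filter Literature.Computability.Complexity
open scoped Topology Classical

/-- Edge positions of `K_n`. -/
abbrev E (n : ℕ) : Type := (⊤ : SimpleGraph (Fin n)).edgeSet

/-- The `k`-clique threshold density `p_θ(n) = n^{-2/(k-1)}`. -/
def pθ (n k : ℕ) : ℝ := (n : ℝ) ^ (-(2 : ℝ) / ((k : ℝ) - 1))

/-- `m_k(n) = ⌊C(n,2) p_θ⌋`, the critical edge count. -/
def mθ (n k : ℕ) : ℕ := ⌊((n.choose 2 : ℕ) : ℝ) * pθ n k⌋₊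

/-- Union of two edge vectors (`x ∪ h`). -/
def sup {n : ℕ} (x h : E n → Bool) : E n → Bool := fun e => x e || h e

/-- `Pr_{G ∼ G(n,p)}[f(G ∪ h) = 1]`. -/
def prOn {n : ℕ} (p : ℝ) (f : (E n → Bool) → Bool) (h : E n → Bool) : ℝ :=
  gnpProb n p (univ.filter fun x => f (sup x h) = true)

/-- The number of non-isolated vertices (support) of an edge vector. -/
def supp {n : ℕ} (h : E n → Bool) : ℕ :=
  #(univ.filter fun v : Fin n => ∃ e : E n, h e = true ∧ v ∈ (e : Sym2 (Fin n)))

/-- Rossman's class `I ∪ J` cut at support `< k` : all patterns with fewer than `k`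
non-isolated vertices that are a union of two patterns of support `< k/2` (this contains `I`,
and `J` is its part of support `≥ k/2`).  Used as the trigger class of the closure. -/
def IJ (n k : ℕ) : Set (E n → Bool) :=
  {h | ∃ h₁ h₂ : E n → Bool, 2 * supp h₁ < k ∧ 2 * supp h₂ < k ∧ h = sup h₁ h₂}

/-- **Self-noise closedness.** `f` is `θ`-closed with respect to the critical law `G(n, p)` and
the trigger class `𝓗`: whenever planting a pattern `h ∈ 𝓗` into the critical random graph makes
`f` fire with probability `≥ 1 - θ`, `f` already accepts the ISOLATED pattern `h`.
(Rossman FOCS'10 Def. 8 with the subcritical `G⁻` replaced by `G(n,p_θ)` itself.) -/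
def IsSelfClosed {n : ℕ} (p θ : ℝ) (𝓗 : Set (E n → Bool)) (f : (E n → Bool) → Bool) : Prop :=
  ∀ h ∈ 𝓗, 1 - θ ≤ prOn p f h → f h = true

/-- `K_A` minus one of its edges `e` (an isolated copy of `K_k⁻`). -/
def cliqueVecMinus {n : ℕ} (A : Finset (Fin n)) (e : E n) : E n → Bool :=
  fun e' => cliqueVec A e' && decide (e' ≠ e)

/-- `K_A` is an exact minterm of `f`: accepted, and every one-edge deletion rejected. -/
def IsCliqueMinterm {n : ℕ} (f : (E n → Bool) → Bool) (A : Finset (Fin n)) : Prop :=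
  f (cliqueVec A) = true ∧ ∀ e : E n, cliqueVec A e = true → f (cliqueVecMinus A e) = false

/-- **First lemma of `self-noise-closure` (negative side for free at ONE density).**
For every `k ≥ 3`, `γ > 0`, `ε > 0`, eventually in `n`: if a monotone graph function `f`
rejects the critical random graph with probability at least `γ` (for an accurate circuit,
`γ ≈ e^{-1/k!} - δ`) and accepts a `(1-ε)`-fraction of the ISOLATED `k`-cliques, then a
`(1 - (C(k,2)+2) ε)`-fraction of the `k`-cliques are exact minterms of `f`.
Mechanism: every proper subgraph of `K_k` is supercritical AT `p_θ` (strict balance), so a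
positive fraction of accepted isolated `K_k⁻`-copies would be present in `G(n,p_θ)` a.s.
(Janson), forcing `f(G)=1` a.s. — no second density, no closure needed. -/
def SelfNoiseMinterms : Prop :=
  ∀ k : ℕ, 3 ≤ k → ∀ γ ε : ℝ, 0 < γ → 0 < ε → ∀ᶠ n : ℕ in atTop,
    ∀ f : (E n → Bool) → Bool, Monotone f →
      gnpProb n (pθ n k) (univ.filter fun x => f x = true) ≤ 1 - γ →
      1 - ε ≤ kSubsetProb n k (fun A => f (cliqueVec A) = true) →
      1 - ((k.choose 2 : ℕ) + 2) * ε ≤ kSubsetProb n k (fun A => IsCliqueMinterm f A)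

/-- `h` is an exact minterm of `f`: accepted, every one-edge deletion rejected. -/
def IsMinterm {n : ℕ} (f : (E n → Bool) → Bool) (h : E n → Bool) : Prop :=
  f h = true ∧ ∀ e : E n, h e = true → f (fun e' => h e' && decide (e' ≠ e)) = false

/-- **Few bounded minterms of a self-closed function (Lemma 9 at the critical density).**
If `f` is `n^{-c₀ k}`-self-closed w.r.t. the class `IJ`, then for every edge number `s` and
support `v` the number of minterms of `f` in `IJ` with `s` edges and support `v` is
`≤ n^{(2/(k-1)) s (1+ε)}` eventually (the `O_k(1)` isomorphism classes are absorbed in `ε`):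
the (p,q)-sunflower / spread lemma run with the `p_θ`-biased `W` (held text Lemma 6; ALWZ form
behind in-tree `RobustSunflowerBound`), the forced core being accepted by self-closedness. -/
def SelfClosedFewMinterms : Prop :=
  ∀ k c₀ : ℕ, 3 ≤ k → 0 < c₀ → ∀ ε : ℝ, 0 < ε → ∀ᶠ n : ℕ in atTop,
    ∀ f : (E n → Bool) → Bool, Monotone f →
      IsSelfClosed (pθ n k) ((n : ℝ) ^ (-(c₀ : ℝ) * k)) (IJ n k) f →
      ∀ s v : ℕ, 0 < s →
        (#(univ.filter fun h : E n → Bool =>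
            h ∈ IJ n k ∧ edgeCount h = s ∧ supp h = v ∧ IsMinterm f h) : ℝ)
          ≤ (n : ℝ) ^ ((2 : ℝ) / ((k : ℝ) - 1) * s * (1 + ε))

/-- **The crux-let isolated by the card (`PositiveTrigger`).**  For a monotone circuit of size
`≤ n^c`, let `f` be any monotone function dominating it gate-by-gate through self-closure
(abstracted here: `f ≥ C.eval`, `f` self-closed, and `f` differs from `C.eval` on `G(n,p_θ)`
and on each planted law with probability `≤ n^{-k}`).  If `f` accepts the PLANTED clique
`G ∪ K_A` with probability `≥ 1 - δ` (averaged over `A`), then `f` accepts a constant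
fraction of ISOLATED cliques.  This is the one step where the single density must be paid
for; the card explains why it is plausible for circuit-generated `f` and false for general `f`. -/
def PositiveTrigger (c : ℕ) : Prop :=
  ∀ k : ℕ, 3 ≤ k → ∃ δ η : ℝ, 0 < δ ∧ 0 < η ∧ ∀ᶠ n : ℕ in atTop,
    ∀ C : Circuit (E n), C.IsOver monotoneBasis → C.size ≤ n ^ c →
    ∀ f : (E n → Bool) → Bool, Monotone f → (∀ x, C.eval x = true → f x = true) →
      IsSelfClosed (pθ n k) ((n : ℝ) ^ (-(k : ℝ) - c - 2)) (IJ n k) f →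
      gnpProb n (pθ n k) (univ.filter fun x => f x ≠ C.eval x) ≤ (n : ℝ) ^ (-(k : ℝ)) →
      1 - δ ≤ ((n.choose k : ℕ) : ℝ)⁻¹ * ∑ A ∈ powersetCard k (univ : Finset (Fin n)),
              prOn (pθ n k) f (cliqueVec A) →
      η ≤ kSubsetProb n k (fun A => f (cliqueVec A) = true)

/-! ### Card `error-profile-rigidity` -/

/-- False-positive density of `f` against `k`-CLIQUE on the slice of edge count `j`:
`#{x : |x| = j, f x = 1, no k-clique} / #{x : |x| = j}`. -/
def sliceFP (n k j : ℕ) (f : (E n → Bool) → Bool) : ℝ :=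
  (#(univ.filter fun x : E n → Bool => edgeCount x = j ∧ f x = true ∧ cliqueFn n k x = false) : ℝ) /
    #(univ.filter fun x : E n → Bool => edgeCount x = j)

/-- False-negative density of `f` on slice `j`. -/
def sliceFN (n k j : ℕ) (f : (E n → Bool) → Bool) : ℝ :=
  (#(univ.filter fun x : E n → Bool => edgeCount x = j ∧ f x = false ∧ cliqueFn n k x = true) : ℝ) /
    #(univ.filter fun x : E n → Bool => edgeCount x = j)

/-- **First lemma of `error-profile-rigidity` (MEP).** For EVERY monotone `f` (no size bound),
across the critical window the false-positive density is almost non-decreasing and the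
false-negative density almost non-increasing at the scale `√m`:
for `j ≤ j' ≤ j + ⌊√m⌋` central, `FP_{j'} ≥ (1-ε) FP_j` and `FN_j ≥ (1-ε) FN_{j'}`.
Proof sketch: double-count pairs `(x, S)` with `x` a false positive on slice `j` and `S` a set of
`j'-j` absent edges; `x ∪ S` stays in the up-set `{f = 1}`, stays clique-free unless `S` contains
one of the `O(n^{2/(k-1)} log n)` clique-completing edges of a typical `x` (fraction
`O((j'-j) n^{2/(k-1)} log n / C(n,2)) = o(1)`), and each `y` on slice `j'` has exactly
`C(j', j'-j)` such representations, while `C(N,j) C(N-j,s) = C(N,j+s) C(j+s,s)`. -/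
def ErrorProfileRigidity : Prop :=
  ∀ k : ℕ, 3 ≤ k → ∀ ε : ℝ, 0 < ε → ∀ᶠ n : ℕ in atTop,
    ∀ f : (E n → Bool) → Bool, Monotone f →
    ∀ j j' : ℕ, |(j : ℝ) - mθ n k| ≤ (mθ n k : ℝ) ^ ((3 : ℝ) / 4) →
      j ≤ j' → (j' : ℝ) ≤ j + Real.sqrt (mθ n k) →
        (1 - ε) * sliceFP n k j f - ε * (n : ℝ)⁻¹ ≤ sliceFP n k j' f ∧
        (1 - ε) * sliceFN n k j' f - ε * (n : ℝ)⁻¹ ≤ sliceFN n k j f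

/-- Consequence used by the route: accuracy under the binomial mixture `G(n,p_θ)` (the crux's
hypothesis shape) gives accuracy on EVERY central slice, uniformly — the converse bookkeeping of
`BandImpliesThreshold`, obtained from MEP plus "accurate on most slices". -/
def MixtureToEverySlice : Prop :=
  ∀ k : ℕ, 3 ≤ k → ∀ ε : ℝ, 0 < ε → ∃ δ : ℝ, 0 < δ ∧ ∀ᶠ n : ℕ in atTop,
    ∀ f : (E n → Bool) → Bool, Monotone f →
      gnpProb n (pθ n k) (univ.filter fun x => f x ≠ cliqueFn n k x) ≤ δ →
      ∀ j : ℕ, |(j : ℝ) - mθ n k| ≤ Real.sqrt (mθ n k) →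
        sliceFP n k j f ≤ ε ∧ sliceFN n k j f ≤ ε

/-- The `L`-local part of a monotone function: accepted through a minterm with `≤ L` edges. -/
def localPart {n : ℕ} (L : ℕ) (f : (E n → Bool) → Bool) (x : E n → Bool) : Bool :=
  decide (∃ h : E n → Bool, h ≤ x ∧ edgeCount h ≤ L ∧ IsMinterm f h)

/-- **Local parts are coarse (structural fact N7 of the negative notes).** For every monotone `f`
and every `L`, the `L`-local part moves by at most `L·log(q'/q)` between densities `q ≤ q'`:
Russo's formula, and at an accepted input every PRESENT pivotal edge lies in every present
minterm, so `q · dμ_q/dq = E_q[#present pivotal] ≤ L · μ_q ≤ L`.  Consequently the forced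
climb of a small accurate circuit just above `p_θ` (Rossman Thm 1) is carried by minterms of
size `> L` only, for every fixed `L`. [folklore: Russo–Margulis for `L`-local up-sets] -/
def LocalPartCoarse : Prop :=
  ∀ (n L : ℕ) (f : (E n → Bool) → Bool), Monotone f →
    ∀ q q' : ℝ, 0 < q → q ≤ q' → q' ≤ 1 →
      gnpProb n q' (univ.filter fun x => localPart L f x = true) -
        gnpProb n q (univ.filter fun x => localPart L f x = true) ≤ L * Real.log (q' / q)

end Summit.PneNP.PneNP.Cruxes.SingleThreshold.Ideator2
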